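import Literature.AlgebraicGeometry.Motives.AbelianVarietyWeilPairingAlongIsogeny
import Literature.AlgebraicGeometry.Motives.AbelianVarietyWeilPairingDivisorClass
import Literature.AlgebraicGeometry.Motives.AbelianVarietyPrincipalPolarizationMultiplicity
import Literature.AlgebraicGeometry.Motives.CartierDivisorFrobeniusPullback
import HarnessLib

/-!
# The level Weil pairing along the relative Frobenius: `ē^{Θ^{(q)}}_M(F a, F b) = ē^{Θ}_{qM}(a, b)`
# (Oda 1969 §1 Cor. 1.3 «`⟨F x, y⟩ = ⟨x, V y⟩^σ`»; Mumford AV §20; Demazure 1972 II §5)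
Topic `Literature/AlgebraicGeometry/Motives`, namespace `Literature.AlgebraicGeometry.Motives.AbelianVariety`.
THEOREMS ONLY (no definition, no named fact, no instance, no notation; net Literature debt 0).
Cell `hodgecm-mathlib` (D-0151), FLOOR-0 P6 «MOD», ST-0 package, row **(DF)** «`F^* λ^{(q)} = q · λ`» in the
tree's Weil-pairing currency (`weilPairingLevel`, `weilDiv`, `CartierDivisor`).
## Mathematics
Let `A` be an abelian variety over a field `K` of exponential characteristic `p`, `q = p ^ n`, `A^{(q)}` its
Frobenius twist with projection `pr : A^{(q)} → A` (`twistFst`), `F = F_{A/K} : A → A^{(q)}` the relative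
`q`-Frobenius, and `Θ` a Cartier divisor on `A` with twist `Θ^{(q)} := pr^* Θ` on `A^{(q)}`.
* §1 `weilDiv_pullback_relFrobenius_twist_linEquiv`: **`D_Q(F^* Θ^{(q)}) ∼ q • D_Q(Θ)`** for every `Q ∈ A(K)` — the
  divisor form of `F^∨ ∘ φ_{Θ^{(q)}} ∘ F = q · φ_Θ`, immediate from ★ `F^* Θ^{(q)} = q • Θ`
  (`CartierDivisor.pullback_relFrobenius_twist_sameDivisor`, Shimura's «`π⁻¹(X̃^f) = pX̃`») and ★ `D_Q(m • Θ) ∼ m • D_Q(Θ)`.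
* §2 `weilPairingLevel_relFrobenius_eq` (HEAD): for `a, b ∈ A[qM](K)` with `F a = P`, `F b = Q` in `A^{(q)}[M](K)`
  (and `A(K)` `q`-divisible, `A^{(q)}(K)` `qM`-divisible, e.g. `K` algebraically closed):
  **`ē^{Θ^{(q)}}_M(P, Q) = ē^{Θ}_{qM}(a, b)`** — the mixed-level identity ★ `weilPairingLevel_map_map_eq_of_mixedLevel`
  along `ψ := F`, `ν := q`.  Read with `a, b ∈ A[M]` this is «`ē^{Θ^{(q)}}_M(F a, F b) = ē^Θ_M(a, b)^q = σ(ē^Θ_M(a, b))`»,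
  i.e. the `F`–`V` adjunction `⟨F x, F y⟩ = ⟨x, y⟩^σ` under the `λ_Θ`-pairing, equivalently `F^* λ^{(q)} = q λ`.
## References
* [Oda1969] T. Oda, *The first de Rham cohomology group and Dieudonné modules*, Ann. Sci. ÉNS (4) 2 (1969), §1 Cor. 1.3.
* [MumfordAV1970] D. Mumford, *Abelian Varieties*, §15 Thm. 1, §20 (1)–(3).
* [Demazure1972] M. Demazure, *Lectures on p-divisible groups*, LNM 302, II §5 (pp. 21–22).
* [Shimura1998] G. Shimura, *Abelian Varieties with Complex Multiplication and Modular Functions*, proof of Thm. 18.6, p. 130.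
-/

universe u

open CategoryTheory CategoryTheory.Limits AlgebraicGeometry MonoidalCategory CartesianMonoidalCategory

noncomputable section

namespace Literature.AlgebraicGeometry.Motives

open scoped MonObj
open RatFn

namespace AbelianVariety

variable {K : Type u} [Field K] (p : ℕ) [ExpChar K p] (n : ℕ) (A : AbelianVariety K)

/-! ### §1 The divisor form: `D_Q(F^* Θ^{(q)}) ∼ q • D_Q(Θ)` -/

/-- **`D_Q(F_{A/K}^* Θ^{(q)}) ∼ q • D_Q(Θ)`** for every rational point `Q` (the divisor form of
`F^∨ ∘ φ_{Θ^{(q)}} ∘ F = q · φ_Θ`): `F^* Θ^{(q)} = q • Θ` as divisors and `D_Q(q • Θ) ∼ q • D_Q(Θ)`.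
[cite: Shimura1998, proof of Thm. 18.6 p. 130 («π⁻¹(X̃^f) = pX̃»)] [cite: MumfordAV1970, §8 (property (iv) of φ_L)] -/
theorem weilDiv_pullback_relFrobenius_twist_linEquiv (π : (A.frobeniusTwist p n).X.left ⟶ A.X.left)
    (hπ : π = twistFst p n A.X) [IsDominant π] [IsDominant (Hom.toSchemeHom (A.relFrobenius p n))]
    (Θ : CartierDivisor A.X.left) (Q : A.Points K) :
    (A.weilDiv ((Θ.pullback π).pullback (Hom.toSchemeHom (A.relFrobenius p n))) Q).LinEquiv
      ((p ^ n) • A.weilDiv Θ Q) :=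
  (A.weilDiv_congr_sameDivisor (A.pullback_relFrobenius_twist_sameDivisor p n π hπ Θ) Q).linEquiv.trans
    (A.weilDiv_smul_linEquiv Θ Q (p ^ n))

/-! ### §2 The pairing form: `ē^{Θ^{(q)}}_M(F a, F b) = ē^{Θ}_{qM}(a, b)` -/

/-- **THE LEVEL WEIL PAIRING ALONG THE RELATIVE FROBENIUS**: for `a, b ∈ A[qM](K)` with images
`P = F a`, `Q = F b ∈ A^{(q)}[M](K)` (`A(K)` `q`-divisible, `A^{(q)}(K)` `qM`-divisible):
`ē^{Θ^{(q)}}_M(P, Q) = ē^{Θ}_{qM}(a, b)`, where `Θ^{(q)} = pr^* Θ`.  With `a, b ∈ A[M]` this reads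
`ē^{Θ^{(q)}}_M(F a, F b) = ē^Θ_M(a, b)^q`: the `F`–`V` adjunction under the `λ_Θ`-pairing, i.e. `F^* λ^{(q)} = q · λ`.
[cite: Oda1969, §1 Cor. 1.3] [cite: MumfordAV1970, §20 (properties (1)–(3) of e_n, pp. 184–186)]
[cite: Demazure1972, II §5 (pp. 21–22)] -/
theorem weilPairingLevel_relFrobenius_eq (π : (A.frobeniusTwist p n).X.left ⟶ A.X.left)
    (hπ : π = twistFst p n A.X) [IsDominant π] [IsDominant (Hom.toSchemeHom (A.relFrobenius p n))]
    (Θ : CartierDivisor A.X.left) {M : ℕ}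
    [IsDominant (Hom.toSchemeHom ((M : ℤ) • 𝟙 (A.frobeniusTwist p n)))]
    [IsDominant (Hom.toSchemeHom (((p ^ n : ℕ) : ℤ) • 𝟙 (A.frobeniusTwist p n)))]
    [IsDominant (Hom.toSchemeHom (((p ^ n * M : ℕ) : ℤ) • 𝟙 A))]
    [IsDominant (Hom.toSchemeHom (((p ^ n * M : ℕ) : ℤ) • 𝟙 (A.frobeniusTwist p n)))]
    (hdivA : Function.Surjective fun R : A.Points K => R ^ (p ^ n))
    (hdivB : Function.Surjective fun R : (A.frobeniusTwist p n).Points K => R ^ (p ^ n * M))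
    (a b : A.torsionPoints K ((p ^ n * M : ℕ) : ℤ)) (P Q : (A.frobeniusTwist p n).torsionPoints K M)
    (hP : (P : (A.frobeniusTwist p n).Points K) = AlgPoints.map (A.relFrobenius p n).hom.hom.hom a.1)
    (hQ : (Q : (A.frobeniusTwist p n).Points K) = AlgPoints.map (A.relFrobenius p n).hom.hom.hom b.1) :
    (A.frobeniusTwist p n).weilPairingLevel (Θ.pullback π) P Q = A.weilPairingLevel (N := p ^ n * M) Θ a b := by
  exact weilPairingLevel_map_map_eq_of_mixedLevel (A.relFrobenius p n) Θ (Θ.pullback π)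
    (fun R => A.weilDiv_pullback_relFrobenius_twist_linEquiv p n π hπ Θ R) hdivA hdivB a b P Q hP hQ

end AbelianVariety

end Literature.AlgebraicGeometry.Motives

end
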